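import Literature.Geometry.Riemannian.CylinderChartScalarPrinted
import Literature.Geometry.Riemannian.NormalFormSpaceDerivatives
import Literature.Geometry.Lorentzian.CoordCurvatureNormEvolution
import HarnessLib

/-!
# Local uniform bounds for the chart data of a generalized cylinder (Bär–Hanke 2023, §3)

Topic `Literature/Geometry/Riemannian`. A brick (K3c of the notes) of the proof of the named
fact `Literature.Geometry.Riemannian.BarHanke2023_thm27_umbilicNormalForm`. "By compactness the
constants are independent of `t`, `ξ`, `δ`, `C`" (Bär–Hanke, pp. 12–13): near every point `z₀`
of `N` there are a neighbourhood `S` and a constant `b ≥ 1` bounding, in the chart at `z₀` and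
for times `|t| ≤ 1`, the slice components `F(y, t)` of the cylinder metric `G`, their first two
space derivatives `F₁ = D_yF`, `F₂ = D²_yF`, the first two time derivatives and the Taylor
remainders in `t` of all three (`UniformTimeTaylorBounds.lean`), the inverse `♯` of the slices,
and `μ̃ = μ ∘ ψ⁻¹` with its first two derivatives (`exists_local_chart_bounds`). The global
constant of the proof of Thm. 27 is then a maximum over a finite subcover of the compact `N`.
Everything is proved; no definitions, no named facts (D-0026).

## References

* C. Bär, B. Hanke, *Boundary conditions for scalar curvature*, arXiv:2012.09127, §3, proofs of
  Props. 23, 26 ("the constant is independent of …"). [BarHanke2023]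
-/

noncomputable section

set_option maxSynthPendingDepth 3

open Bundle Set Filter Function Metric TopologicalSpace
open scoped Manifold ContDiff Topology

namespace Literature.Geometry.Riemannian

open Literature.Geometry.Lorentzian
open Literature.Geometry.Lorentzian.PseudoRiemannianMetric
open Literature.Geometry.Lorentzian.MetricCoord

variable {E' : Type*} [NormedAddCommGroup E'] [InnerProductSpace ℝ E'] [FiniteDimensional ℝ E']
  {N : Type*} [TopologicalSpace N] [ChartedSpace E' N] [IsManifold 𝓘(ℝ, E') ∞ N]
  (G : PseudoRiemannianMetric (𝓘(ℝ, E').prod 𝓘(ℝ, ℝ)) ∞ (E' × ℝ)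
    (TangentSpace (𝓘(ℝ, E').prod 𝓘(ℝ, ℝ)) : N × ℝ → Type _))
  (hG : G.IsRiemannian)

omit [InnerProductSpace ℝ E'] [FiniteDimensional ℝ E'] in
/-- Bounds of a continuous function on `K × [-1, 1]`, `K` compact. [folklore] -/
theorem exists_bound_on_prod_Icc {W : Type*} [NormedAddCommGroup W] {f : E' × ℝ → W}
    {U K : Set E'} (hK : IsCompact K) (hKU : K ⊆ U) (hf : ContinuousOn f (U ×ˢ univ)) :
    ∃ B : ℝ, 0 ≤ B ∧ ∀ y ∈ K, ∀ t ∈ Icc (-1 : ℝ) 1, ‖f (y, t)‖ ≤ B := by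
  obtain ⟨B, hB⟩ := (hK.prod (isCompact_Icc (a := (-1 : ℝ)) (b := 1))).exists_bound_of_continuousOn
    (hf.mono (prod_mono hKU (subset_univ _)))
  exact ⟨max B 0, le_max_right _ _, fun y hy t ht ↦ (hB (y, t) ⟨hy, ht⟩).trans (le_max_left _ _)⟩

omit [InnerProductSpace ℝ E'] [FiniteDimensional ℝ E'] in
/-- Bounds of a continuous function on a compact `K`. [folklore] -/
theorem exists_bound_on {W : Type*} [NormedAddCommGroup W] {f : E' → W}
    {U K : Set E'} (hK : IsCompact K) (hKU : K ⊆ U) (hf : ContinuousOn f U) :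
    ∃ B : ℝ, 0 ≤ B ∧ ∀ y ∈ K, ‖f y‖ ≤ B := by
  obtain ⟨B, hB⟩ := hK.exists_bound_of_continuousOn (hf.mono hKU)
  exact ⟨max B 0, le_max_right _ _, fun y hy ↦ (hB y hy).trans (le_max_left _ _)⟩

set_option maxSynthPendingDepth 4 in
set_option synthInstance.maxHeartbeats 400000 in
set_option maxHeartbeats 1600000 in
/-- **Local uniform bounds for the chart data** (the compactness bookkeeping of Bär–Hanke's §3):
near `z₀` there are `S ∈ 𝓝 z₀` inside the chart domain and `b ≥ 1` such that, with `F` the slice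
components of `G` in the chart `ψ = chartAt z₀`, `F₁ = D_yF`, `F₂ = D²_yF`, `μ̃ = μ ∘ ψ⁻¹`, for
all `z ∈ S` and `|t| ≤ 1` the twenty-two quantities listed are bounded by `b` (values, two time
derivatives and Taylor remainders of `F, F₁, F₂`; `‖♯‖`; `μ̃, Dμ̃, D²μ̃`).
[cite: BarHanke2023, §3, proofs of Props. 23 and 26] -/
theorem exists_local_chart_bounds {μ : N → ℝ} (hμ : ContMDiff 𝓘(ℝ, E') 𝓘(ℝ, ℝ) ∞ μ) (z₀ : N) :
    ∃ S ∈ 𝓝 z₀, ∃ b : ℝ, 1 ≤ b ∧ S ⊆ (chartAt E' z₀).source ∧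
    ∃ (F : E' → ℝ → E' →L[ℝ] E' →L[ℝ] ℝ) (F₁ : E' → ℝ → E' →L[ℝ] E' →L[ℝ] E' →L[ℝ] ℝ)
      (F₂ : E' → ℝ → E' →L[ℝ] E' →L[ℝ] E' →L[ℝ] E' →L[ℝ] ℝ),
      (∀ (y : E') (s : ℝ), F y s = MaxAtlasChart.metricRepr
        (G.inducedMetric (fun x : N ↦ ((x, s) : N × ℝ))
          (contMDiff_pullbackBilin_holds (I := 𝓘(ℝ, E').prod 𝓘(ℝ, ℝ)) (M := N × ℝ)
            (I' := 𝓘(ℝ, E')) (N := N))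
          (isSpacelikeImmersion_cylSlice G hG s)) (IsManifold.chart_mem_maximalAtlas (I := 𝓘(ℝ, E')) z₀) y) ∧
      (∀ (y : E') (s : ℝ), F₁ y s =
        (fderiv ℝ (fun q : E' × ℝ ↦ F q.1 q.2) (y, s)).comp (ContinuousLinearMap.inl ℝ E' ℝ)) ∧
      (∀ (y : E') (s : ℝ), F₂ y s =
        (fderiv ℝ (fun q : E' × ℝ ↦ F₁ q.1 q.2) (y, s)).comp (ContinuousLinearMap.inl ℝ E' ℝ)) ∧
      ∀ z ∈ S, ∀ t ∈ Icc (-1 : ℝ) 1,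
        (‖F (chartAt E' z₀ z) t‖ ≤ b ∧ ‖deriv (F (chartAt E' z₀ z)) t‖ ≤ b ∧
          ‖deriv (deriv (F (chartAt E' z₀ z))) t‖ ≤ b ∧
          ‖F (chartAt E' z₀ z) t - F (chartAt E' z₀ z) 0‖ ≤ b * |t| ∧
          ‖deriv (F (chartAt E' z₀ z)) t - deriv (F (chartAt E' z₀ z)) 0‖ ≤ b * |t| ∧
          ‖F (chartAt E' z₀ z) t - F (chartAt E' z₀ z) 0 - t • deriv (F (chartAt E' z₀ z)) 0‖ ≤
            b * t ^ 2) ∧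
        (‖F₁ (chartAt E' z₀ z) t‖ ≤ b ∧ ‖deriv (F₁ (chartAt E' z₀ z)) t‖ ≤ b ∧
          ‖deriv (deriv (F₁ (chartAt E' z₀ z))) t‖ ≤ b ∧
          ‖F₁ (chartAt E' z₀ z) t - F₁ (chartAt E' z₀ z) 0‖ ≤ b * |t| ∧
          ‖deriv (F₁ (chartAt E' z₀ z)) t - deriv (F₁ (chartAt E' z₀ z)) 0‖ ≤ b * |t| ∧
          ‖F₁ (chartAt E' z₀ z) t - F₁ (chartAt E' z₀ z) 0 - t • deriv (F₁ (chartAt E' z₀ z)) 0‖ ≤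
            b * t ^ 2) ∧
        (‖F₂ (chartAt E' z₀ z) t‖ ≤ b ∧ ‖deriv (F₂ (chartAt E' z₀ z)) t‖ ≤ b ∧
          ‖deriv (deriv (F₂ (chartAt E' z₀ z))) t‖ ≤ b ∧
          ‖F₂ (chartAt E' z₀ z) t - F₂ (chartAt E' z₀ z) 0‖ ≤ b * |t| ∧
          ‖deriv (F₂ (chartAt E' z₀ z)) t - deriv (F₂ (chartAt E' z₀ z)) 0‖ ≤ b * |t| ∧
          ‖F₂ (chartAt E' z₀ z) t - F₂ (chartAt E' z₀ z) 0 - t • deriv (F₂ (chartAt E' z₀ z)) 0‖ ≤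
            b * t ^ 2) ∧
        ‖sharpAt (fun y ↦ F y t) (chartAt E' z₀ z)‖ ≤ b ∧
        |μ ((chartAt E' z₀).symm (chartAt E' z₀ z))| ≤ b ∧
        ‖fderiv ℝ (fun y : E' ↦ μ ((chartAt E' z₀).symm y)) (chartAt E' z₀ z)‖ ≤ b ∧
        ‖fderiv ℝ (fderiv ℝ (fun y : E' ↦ μ ((chartAt E' z₀).symm y))) (chartAt E' z₀ z)‖ ≤ b := by
  set ψ := chartAt E' z₀ with hψdef
  have hψ : ψ ∈ IsManifold.maximalAtlas 𝓘(ℝ, E') ∞ N := IsManifold.chart_mem_maximalAtlas z₀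
  -- the three families
  set F : E' → ℝ → E' →L[ℝ] E' →L[ℝ] ℝ := fun y s ↦ MaxAtlasChart.metricRepr
    (G.inducedMetric (fun x : N ↦ ((x, s) : N × ℝ))
      (contMDiff_pullbackBilin_holds (I := 𝓘(ℝ, E').prod 𝓘(ℝ, ℝ)) (M := N × ℝ)
        (I' := 𝓘(ℝ, E')) (N := N))
      (isSpacelikeImmersion_cylSlice G hG s)) hψ y with hFdef
  have hF : ∀ (y : E') (s : ℝ), F y s = MaxAtlasChart.metricRepr
      (G.inducedMetric (fun x : N ↦ ((x, s) : N × ℝ))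
        (contMDiff_pullbackBilin_holds (I := 𝓘(ℝ, E').prod 𝓘(ℝ, ℝ)) (M := N × ℝ)
          (I' := 𝓘(ℝ, E')) (N := N))
        (isSpacelikeImmersion_cylSlice G hG s)) hψ y := fun _ _ ↦ rfl
  set F₁ : E' → ℝ → E' →L[ℝ] E' →L[ℝ] E' →L[ℝ] ℝ := fun y s ↦
    (fderiv ℝ (fun q : E' × ℝ ↦ F q.1 q.2) (y, s)).comp (ContinuousLinearMap.inl ℝ E' ℝ) with hF₁def
  have hF₁ : ∀ (y : E') (s : ℝ), F₁ y s =
      (fderiv ℝ (fun q : E' × ℝ ↦ F q.1 q.2) (y, s)).comp (ContinuousLinearMap.inl ℝ E' ℝ) :=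
    fun _ _ ↦ rfl
  set F₂ : E' → ℝ → E' →L[ℝ] E' →L[ℝ] E' →L[ℝ] E' →L[ℝ] ℝ := fun y s ↦
    (fderiv ℝ (fun q : E' × ℝ ↦ F₁ q.1 q.2) (y, s)).comp (ContinuousLinearMap.inl ℝ E' ℝ) with hF₂def
  have hF₂ : ∀ (y : E') (s : ℝ), F₂ y s =
      (fderiv ℝ (fun q : E' × ℝ ↦ F₁ q.1 q.2) (y, s)).comp (ContinuousLinearMap.inl ℝ E' ℝ) :=
    fun _ _ ↦ rfl
  have hU : IsOpen ψ.target := ψ.open_target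
  have hFs : ContDiffOn ℝ ∞ (fun q : E' × ℝ ↦ F q.1 q.2) (ψ.target ×ˢ univ) :=
    contDiffOn_cylComponents G hG hψ F hF
  have hF₁s : ContDiffOn ℝ ∞ (fun q : E' × ℝ ↦ F₁ q.1 q.2) (ψ.target ×ˢ univ) :=
    contDiffOn_family₁ hU hFs hF₁
  have hF₂s : ContDiffOn ℝ ∞ (fun q : E' × ℝ ↦ F₂ q.1 q.2) (ψ.target ×ˢ univ) :=
    contDiffOn_family₁ hU hF₁s hF₂
  -- a compact ball in the target around `ψ z₀`
  have hz₀ : z₀ ∈ ψ.source := mem_chart_source E' z₀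
  have hy₀ : ψ z₀ ∈ ψ.target := ψ.map_source hz₀
  obtain ⟨r₀, hr₀, hball⟩ := Metric.isOpen_iff.1 hU (ψ z₀) hy₀
  set r : ℝ := r₀ / 2 with hr
  have hrpos : 0 < r := by positivity
  set K : Set E' := closedBall (ψ z₀) r with hK
  have hKc : IsCompact K := isCompact_closedBall _ _
  have hKU : K ⊆ ψ.target := (closedBall_subset_ball (by rw [hr]; linarith)).trans hball
  set S : Set N := ψ.source ∩ ψ ⁻¹' ball (ψ z₀) r with hS
  have hSo : IsOpen S := ψ.continuousOn.isOpen_inter_preimage ψ.open_source isOpen_ball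
  have hSmem : S ∈ 𝓝 z₀ := hSo.mem_nhds ⟨hz₀, by simp [Metric.mem_ball, hrpos]⟩
  have hSK : ∀ z ∈ S, ψ z ∈ K := fun z hz ↦ ball_subset_closedBall hz.2
  -- the bounds
  obtain ⟨B₀, hB₀1, hB₀⟩ := exists_uniform_time_bounds hU hKc hKU hFs
  obtain ⟨B₁, hB₁1, hB₁⟩ := exists_uniform_time_bounds hU hKc hKU hF₁s
  obtain ⟨B₂, hB₂1, hB₂⟩ := exists_uniform_time_bounds hU hKc hKU hF₂s
  have hfam := isMetricFamilyOn_cylComponents G hG hψ F hF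
  obtain ⟨B₃, hB₃0, hB₃⟩ := exists_bound_on_prod_Icc hKc hKU
    hfam.contDiffOn_sharpAt_family.continuousOn
  have hμt : ContDiffOn ℝ ∞ (fun y : E' ↦ μ (ψ.symm y)) ψ.target := by
    have h := hμ.comp_contMDiffOn (contMDiffOn_symm_of_mem_maximalAtlas hψ)
    exact contMDiffOn_iff_contDiffOn.1 h
  obtain ⟨B₄, hB₄0, hB₄⟩ := exists_bound_on hKc hKU hμt.continuousOn
  obtain ⟨B₅, hB₅0, hB₅⟩ := exists_bound_on hKc hKU (hμt.fderiv_of_isOpen (m := ∞) hU le_rfl).continuousOn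
  obtain ⟨B₆, hB₆0, hB₆⟩ := exists_bound_on hKc hKU
    (((hμt.fderiv_of_isOpen (m := ∞) hU le_rfl).fderiv_of_isOpen (m := ∞) hU le_rfl).continuousOn)
  set b : ℝ := B₀ + B₁ + B₂ + B₃ + B₄ + B₅ + B₆ with hb
  have h0b : B₀ ≤ b := by rw [hb]; linarith
  have h1b : B₁ ≤ b := by rw [hb]; linarith
  have h2b : B₂ ≤ b := by rw [hb]; linarith
  have h3b : B₃ ≤ b := by rw [hb]; linarith
  have h4b : B₄ ≤ b := by rw [hb]; linarith
  have h5b : B₅ ≤ b := by rw [hb]; linarith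
  have h6b : B₆ ≤ b := by rw [hb]; linarith
  have hb1 : 1 ≤ b := hB₀1.trans h0b
  -- monotonicity of the six bounds in the constant
  have hmono : ∀ {W : Type _} [NormedAddCommGroup W] [NormedSpace ℝ W] {Φ : E' → ℝ → W} {B : ℝ}
      (y : E') (t : ℝ), B ≤ b →
      (‖Φ y t‖ ≤ B ∧ ‖deriv (Φ y) t‖ ≤ B ∧ ‖deriv (deriv (Φ y)) t‖ ≤ B ∧
        ‖Φ y t - Φ y 0‖ ≤ B * |t| ∧ ‖deriv (Φ y) t - deriv (Φ y) 0‖ ≤ B * |t| ∧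
        ‖Φ y t - Φ y 0 - t • deriv (Φ y) 0‖ ≤ B * t ^ 2) →
      (‖Φ y t‖ ≤ b ∧ ‖deriv (Φ y) t‖ ≤ b ∧ ‖deriv (deriv (Φ y)) t‖ ≤ b ∧
        ‖Φ y t - Φ y 0‖ ≤ b * |t| ∧ ‖deriv (Φ y) t - deriv (Φ y) 0‖ ≤ b * |t| ∧
        ‖Φ y t - Φ y 0 - t • deriv (Φ y) 0‖ ≤ b * t ^ 2) := by
    intro W _ _ Φ B y t hB h
    obtain ⟨e1, e2, e3, e4, e5, e6⟩ := h
    exact ⟨e1.trans hB, e2.trans hB, e3.trans hB,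
      e4.trans (mul_le_mul_of_nonneg_right hB (abs_nonneg t)),
      e5.trans (mul_le_mul_of_nonneg_right hB (abs_nonneg t)),
      e6.trans (mul_le_mul_of_nonneg_right hB (sq_nonneg t))⟩
  refine ⟨S, hSmem, b, hb1, inter_subset_left, F, F₁, F₂, hF, hF₁, hF₂, fun z hz t ht ↦ ?_⟩
  have hyK : ψ z ∈ K := hSK z hz
  refine ⟨hmono (ψ z) t h0b (hB₀ (ψ z) hyK t ht), hmono (ψ z) t h1b (hB₁ (ψ z) hyK t ht),
    hmono (ψ z) t h2b (hB₂ (ψ z) hyK t ht), ?_, ?_, ?_, ?_⟩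
  · exact (hB₃ (ψ z) hyK t ht).trans h3b
  · have h := hB₄ (ψ z) hyK
    rw [Real.norm_eq_abs] at h
    exact h.trans h4b
  · exact (hB₅ (ψ z) hyK).trans h5b
  · exact (hB₆ (ψ z) hyK).trans h6b

end Literature.Geometry.Riemannian

end
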